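import Summits.QuantumFields.YangMills.Theorems.PoincareLipschitzLatticeLuckhausAnnulus
import HarnessLib

/-!
# LINE 25 «CompactnessTransfer» (K2 crux `BlockLipschitzL` stmt-QuantumFields-23533 ∕ crux of record `HistoryTailL` stmt-QuantumFields-19936), S2♭″ (Γ-KNIT) —
# FILE (L) «THE GLUED COMPETITOR ON A GOOD LAYER»: the lattice half of Luckhaus' lemma as the knit consumes it — box translation of energies, the layer
# pigeonhole, the bond-sum split inner ∕ layer around ✓`exists_unit_glue_annulus`, and the ONE statement `exists_glued_competitor_le`: for unit lattice maps
# `u` (the almost-minimiser) and `v` (the recovery sequence), a layer of thickness `h` among `N` disjoint ones in the shell `[a, a + N(h+1)]` carries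
# `≤ 1∕N` of the shell energies, and testing the almost-minimality of `u` with the glued map gives
# `E_u(Q_{ρ₁}) ≤ E_v(Q_{ρ₁−h−1}) + C·(N⁻¹·(E_u + E_v)(Q_{a+N(h+1)}) + 3h⁻²·Σ_{shell} ‖u − v‖²) + δ·ρ₁`.

Cell `ym3-torus` (YM ladder rung R3 = continuum SU(2) Yang–Mills on T³ — a RUNG, NOT the Clay problem: not d = 4, not infinite volume, not a mass gap);
width seat `ym3-torus-px3` gen 8 (the Γ-KNIT pen, LEAD ★w1-19936 g10 12:29:32Z S2♭″ ARCHITECTURE v0).  THEOREMS ONLY (0 `def`, 0 `sorry`, default heartbeats);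
`--supports stmt-QuantumFields-23533 --as helper`.  Pure finite sums on `ℤ³`; no measure theory.
* §1 `energy_translate` (energy of `y ↦ v (y − z)` on `Q_r(z)` = energy of `v` on `Q_r(0)`), `sum_box_le_sum_box` (monotonicity in the radius for `f ≥ 0`).
* §2 `exists_layer_le` — THE LAYER PIGEONHOLE: among the `N` layers `Q_{a+(i+1)(h+1)} ∖ Q_{a+i(h+1)}` one carries `≤ N⁻¹·Σ_{Q_{a+N(h+1)}} W`.
* §3 `energy_split_layer` (bond sum over `Q_{ρ₁}` = inner `Q_{ρ₁−h−1}` + layer), `exists_glued_le` (✓glue + split: the glued map's energy on `Q_{ρ₁}`).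
* §4 ★★★ `exists_glued_competitor_le` — the statement displayed above, with the almost-minimality hypothesis in S2♭″'s own shape.
HONEST SCOPE.  Letters for the knit; S2♭″, S1″, `hHalvingBand`, K1, `MeanDeviationL`, `BlockLipschitzL`, `HistoryTailL` are NOT proved here; YM gap NOT proved.

References: S. Luckhaus, Indiana Univ. Math. J. 37 (1988) 349–367, Lemma 1 [Luckhaus1988]; L. Simon, Theorems on Regularity and Singularity of Energy
Minimizing Maps (1996) §2.6, §2.9 [Simon1996].
-/

set_option autoImplicit false

noncomputable section

open scoped BigOperators
open Finset

namespace Summit.QuantumFields.YangMills.Theorems.PoincareLipschitzLatticeToContinuumLatticeLetters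

open Literature.MathematicalPhysics.QuantumFieldTheory.Balaban1983to89
open B4Eq19LatticeOperators (Zd box unitVec mem_box box_mono add_unitVec_mem_box sum_box_add_right self_mem_box)
open Summit.QuantumFields.YangMills.Theorems.PoincareLipschitzLatticeLuckhausAnnulus (exists_unit_glue_annulus)

/-! ## §1 Translation and monotonicity of box energies -/

/-- The Dirichlet energy of the translate `y ↦ v (y − z)` on `Q_r(z)` is the energy of `v` on `Q_r(0)`. [folklore] -/
theorem energy_translate (v : Zd 3 → EuclideanSpace ℝ (Fin 4)) (z : Zd 3) (r : ℤ) :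
    ∑ y ∈ box z r, ∑ μ : Fin 3, ‖v (y + unitVec μ - z) - v (y - z)‖ ^ 2
      = ∑ y ∈ box (0 : Zd 3) r, ∑ μ : Fin 3, ‖v (y + unitVec μ) - v y‖ ^ 2 := by
  have h := sum_box_add_right (fun y => ∑ μ : Fin 3, ‖v (y + unitVec μ - z) - v (y - z)‖ ^ 2) (0 : Zd 3) z r
  rw [zero_add] at h
  rw [← h]
  refine Finset.sum_congr rfl fun y _ => Finset.sum_congr rfl fun μ _ => ?_
  rw [show y + z + unitVec μ - z = y + unitVec μ by abel, add_sub_cancel_right]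

/-- A sum of nonnegative terms over a box is monotone in the radius. [folklore] -/
theorem sum_box_le_sum_box {f : Zd 3 → ℝ} (hf : ∀ y, 0 ≤ f y) (z : Zd 3) {r r' : ℤ} (h : r ≤ r') :
    ∑ y ∈ box z r, f y ≤ ∑ y ∈ box z r', f y :=
  Finset.sum_le_sum_of_subset_of_nonneg (box_mono z h) fun y _ _ => hf y

/-- Sums of nonnegative terms are monotone under inclusion of the index box into any finset. [folklore] -/
theorem sum_le_sum_of_box_subset {f : Zd 3 → ℝ} (hf : ∀ y, 0 ≤ f y) {z : Zd 3} {r : ℤ} {T : Finset (Zd 3)} (h : box z r ⊆ T) :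
    ∑ y ∈ box z r, f y ≤ ∑ y ∈ T, f y :=
  Finset.sum_le_sum_of_subset_of_nonneg h fun y _ _ => hf y

/-! ## §2 The layer pigeonhole -/

/-- Telescoping: the sum over the `N` disjoint layers `Q_{a+(i+1)(h+1)}(z) ∖ Q_{a+i(h+1)}(z)` is the sum over `Q_{a+N(h+1)} ∖ Q_a`. [folklore] -/
theorem sum_layers_eq (W : Zd 3 → ℝ) (z : Zd 3) (a h N : ℕ) :
    ∑ i ∈ Finset.range N, ∑ y ∈ box z ((a : ℤ) + (i + 1) * (h + 1)) \ box z ((a : ℤ) + i * (h + 1)), W y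
      = ∑ y ∈ box z ((a : ℤ) + N * (h + 1)), W y - ∑ y ∈ box z (a : ℤ), W y := by
  induction N with
  | zero => simp
  | succ n ih =>
    rw [Finset.sum_range_succ, ih]
    have hsub : box z ((a : ℤ) + n * (h + 1)) ⊆ box z ((a : ℤ) + (n + 1) * (h + 1)) :=
      box_mono z (by nlinarith)
    have := Finset.sum_sdiff (f := W) hsub
    simp only [Nat.cast_add, Nat.cast_one]
    linarith

/-- ★ **THE LAYER PIGEONHOLE.**  For `W ≥ 0` and `0 < N`: one of the `N` layers `Q_{a+(i+1)(h+1)}(z) ∖ Q_{a+i(h+1)}(z)`, `i < N`, carries at most `N⁻¹` of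
`Σ_{Q_{a+N(h+1)}(z)} W`. [folklore] [cite: Simon1996, §2.6 Lemma 1 (choice of the good layer)] -/
theorem exists_layer_le (W : Zd 3 → ℝ) (hW : ∀ y, 0 ≤ W y) (z : Zd 3) (a h N : ℕ) (hN : 0 < N) :
    ∃ i : ℕ, i < N ∧ (N : ℝ) * ∑ y ∈ box z ((a : ℤ) + (i + 1) * (h + 1)) \ box z ((a : ℤ) + i * (h + 1)), W y
      ≤ ∑ y ∈ box z ((a : ℤ) + N * (h + 1)), W y := by
  classical
  set S : ℝ := ∑ y ∈ box z ((a : ℤ) + N * (h + 1)), W y with hS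
  have htot : ∑ i ∈ Finset.range N, ∑ y ∈ box z ((a : ℤ) + (i + 1) * (h + 1)) \ box z ((a : ℤ) + i * (h + 1)), W y ≤ S := by
    rw [sum_layers_eq]
    have : 0 ≤ ∑ y ∈ box z (a : ℤ), W y := Finset.sum_nonneg fun y _ => hW y
    linarith
  by_contra H
  push Not at H
  have hlt : ∑ i ∈ Finset.range N, S < ∑ i ∈ Finset.range N,
      (N : ℝ) * ∑ y ∈ box z ((a : ℤ) + (i + 1) * (h + 1)) \ box z ((a : ℤ) + i * (h + 1)), W y :=
    Finset.sum_lt_sum_of_nonempty (Finset.nonempty_range_iff.2 hN.ne') fun i hi => H i (Finset.mem_range.1 hi)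
  rw [Finset.sum_const, Finset.card_range, nsmul_eq_mul, ← Finset.mul_sum] at hlt
  have hN0 : (0 : ℝ) < N := by exact_mod_cast hN
  have := mul_le_mul_of_nonneg_left htot hN0.le
  linarith

/-! ## §3 The bond-sum split around the glued layer -/

/-- The bond energy over `Q_{ρ₁}(z)` splits into the inner box `Q_{ρ₁−h−1}(z)` and the layer `Q_{ρ₁}(z) ∖ Q_{ρ₁−h−1}(z)`. [folklore] -/
theorem energy_split_layer (f : Zd 3 → ℝ) (z : Zd 3) (ρ₁ h : ℕ) :
    ∑ y ∈ box z (ρ₁ : ℤ), f y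
      = ∑ y ∈ box z ((ρ₁ : ℤ) - h - 1), f y + ∑ y ∈ box z (ρ₁ : ℤ) \ box z ((ρ₁ : ℤ) - h - 1), f y := by
  have hsub : box z ((ρ₁ : ℤ) - h - 1) ⊆ box z (ρ₁ : ℤ) := box_mono z (by linarith [(Nat.cast_nonneg h : (0:ℤ) ≤ h)])
  rw [← Finset.sum_sdiff hsub, add_comm]

/-- ★ **✓glue + split.**  For unit `u, v`, centre `z`, `1 ≤ h`, `h + 1 ≤ ρ₁`: a UNIT lattice map `w` with `w = u` off `Q_{ρ₁−1}(z)` and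
`E_w(Q_{ρ₁}(z)) ≤ E_v(Q_{ρ₁−h−1}(z)) + C·(Σ_{layer} Σ_μ (‖δu‖² + ‖δv‖²) + (h⁻¹)²·3·Σ_{layer} ‖u − v‖²)`, `layer = Q_{ρ₁}(z) ∖ Q_{ρ₁−h−1}(z)`,
`C` = ✓`exists_unit_glue_annulus`'s constant. [cite: Luckhaus1988, Lemma 1] -/
theorem exists_glued_le : ∃ C : ℝ, 0 ≤ C ∧
    ∀ (u v : Zd 3 → EuclideanSpace ℝ (Fin 4)) (z : Zd 3) (ρ₁ h : ℕ),
      (∀ y, ‖u y‖ = 1) → (∀ y, ‖v y‖ = 1) → 1 ≤ h → h + 1 ≤ ρ₁ →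
      ∃ w : Zd 3 → EuclideanSpace ℝ (Fin 4), (∀ y, ‖w y‖ = 1) ∧ (∀ y, y ∉ box z ((ρ₁ : ℤ) - 1) → w y = u y) ∧
        ∑ y ∈ box z (ρ₁ : ℤ), ∑ μ : Fin 3, ‖w (y + unitVec μ) - w y‖ ^ 2 ≤
          (∑ y ∈ box z ((ρ₁ : ℤ) - h - 1), ∑ μ : Fin 3, ‖v (y + unitVec μ) - v y‖ ^ 2) +
          C * ((∑ y ∈ box z (ρ₁ : ℤ) \ box z ((ρ₁ : ℤ) - h - 1), ∑ μ : Fin 3,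
                  (‖u (y + unitVec μ) - u y‖ ^ 2 + ‖v (y + unitVec μ) - v y‖ ^ 2)) +
               ((h : ℝ)⁻¹) ^ 2 * (3 * ∑ y ∈ box z (ρ₁ : ℤ) \ box z ((ρ₁ : ℤ) - h - 1), ‖u y - v y‖ ^ 2)) := by
  classical
  obtain ⟨C, hC0, hC⟩ := exists_unit_glue_annulus
  refine ⟨C, hC0, ?_⟩
  intro u v z ρ₁ h hu hv h1 hhρ
  set layer : Finset (Zd 3) := box z (ρ₁ : ℤ) \ box z ((ρ₁ : ℤ) - h - 1) with hlayer
  obtain ⟨w, hw1, hwu, hwv, hwE⟩ := hC u v z ρ₁ h hu hv h1 (by omega) (layer ×ˢ (Finset.univ : Finset (Fin 3)))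
  refine ⟨w, hw1, hwu, ?_⟩
  rw [energy_split_layer (fun y => ∑ μ : Fin 3, ‖w (y + unitVec μ) - w y‖ ^ 2) z ρ₁ h]
  -- inner box: `w = v` at both ends of every bond
  have hin : ∑ y ∈ box z ((ρ₁ : ℤ) - h - 1), ∑ μ : Fin 3, ‖w (y + unitVec μ) - w y‖ ^ 2
      = ∑ y ∈ box z ((ρ₁ : ℤ) - h - 1), ∑ μ : Fin 3, ‖v (y + unitVec μ) - v y‖ ^ 2 := by
    refine Finset.sum_congr rfl fun y hy => Finset.sum_congr rfl fun μ _ => ?_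
    have hy' : y ∈ box z ((ρ₁ : ℤ) - h) := box_mono z (by linarith) hy
    have hyμ : y + unitVec μ ∈ box z ((ρ₁ : ℤ) - h) := by
      have := add_unitVec_mem_box hy μ
      simpa using this
    rw [hwv y hy', hwv _ hyμ]
  -- the layer: bonds indexed by `layer ×ˢ univ`
  have hprod : ∀ g : Zd 3 → Fin 3 → ℝ, ∑ y ∈ layer, ∑ μ : Fin 3, g y μ = ∑ e ∈ layer ×ˢ (Finset.univ : Finset (Fin 3)), g e.1 e.2 :=
    fun g => by rw [Finset.sum_product]
  have hfilter : (layer ×ˢ (Finset.univ : Finset (Fin 3))).filter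
      (fun e => e.1 ∈ box z (ρ₁ : ℤ) ∧ e.1 ∉ box z ((ρ₁ : ℤ) - h - 1)) = layer ×ˢ (Finset.univ : Finset (Fin 3)) := by
    refine Finset.filter_true_of_mem fun e he => ?_
    rw [Finset.mem_product] at he
    exact Finset.mem_sdiff.1 he.1
  rw [hfilter] at hwE
  have hmis : ∑ e ∈ layer ×ˢ (Finset.univ : Finset (Fin 3)), ‖u e.1 - v e.1‖ ^ 2 = 3 * ∑ y ∈ layer, ‖u y - v y‖ ^ 2 := by
    rw [← hprod (fun y _ => ‖u y - v y‖ ^ 2)]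
    simp only [Finset.sum_const, Finset.card_univ, Fintype.card_fin, nsmul_eq_mul, Nat.cast_ofNat]
    rw [Finset.mul_sum]
  rw [hin, hprod, hprod]
  rw [hmis] at hwE
  linarith

/-! ## §4 ★★★ The glued competitor on a good layer, tested against almost-minimality -/

/-- ★★★ **THE GLUED COMPETITOR ON A GOOD LAYER.**  There is `C ≥ 0` such that: for unit lattice maps `u, v : ℤ³ → S³`, centres `Z, z`, a radius `R`,
a slack `δ ≥ 0` with `u` `δ`-almost-minimising in every sub-box of `Q_R(Z)` (S2♭″'s clause), and `a, h, N` with `1 ≤ h`, `0 < N`,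
`Q_{a+N(h+1)}(z) ⊆ Q_R(Z)`, there is `ρ₁ ∈ [a + h + 1, a + N(h+1)]` with
`E_u(Q_{ρ₁}(z)) ≤ E_v(Q_{ρ₁−h−1}(z)) + C·(N⁻¹·Σ_{Q_{a+N(h+1)}(z)} Σ_μ(‖δu‖² + ‖δv‖²) + (h⁻¹)²·3·Σ_{Q_{a+N(h+1)}(z) ∖ Q_a(z)} ‖u − v‖²) + δ·ρ₁`.
[cite: Luckhaus1988, Lemma 1; Simon1996, §2.9 Lemma 1] -/
theorem exists_glued_competitor_le : ∃ C : ℝ, 0 ≤ C ∧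
    ∀ (u v : Zd 3 → EuclideanSpace ℝ (Fin 4)) (Z z : Zd 3) (R : ℤ) (δ : ℝ),
      (∀ y, ‖u y‖ = 1) → (∀ y, ‖v y‖ = 1) → 0 ≤ δ →
      (∀ (z' : Zd 3) (ρ : ℤ), 0 ≤ ρ → box z' (ρ + 1) ⊆ box Z R →
        ∀ w : Zd 3 → EuclideanSpace ℝ (Fin 4), (∀ y, y ∉ box z' ρ → w y = u y) → (∀ y ∈ box z' ρ, ‖w y‖ = 1) →
        ∑ y ∈ box z' (ρ + 1), ∑ μ : Fin 3, ‖u (y + unitVec μ) - u y‖ ^ 2 ≤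
        (∑ y ∈ box z' (ρ + 1), ∑ μ : Fin 3, ‖w (y + unitVec μ) - w y‖ ^ 2) + δ * ((ρ : ℝ) + 1)) →
      ∀ (a h N : ℕ), 1 ≤ h → 0 < N → box z ((a : ℤ) + N * (h + 1)) ⊆ box Z R →
      ∃ ρ₁ : ℕ, a + (h + 1) ≤ ρ₁ ∧ ρ₁ ≤ a + N * (h + 1) ∧
        ∑ y ∈ box z (ρ₁ : ℤ), ∑ μ : Fin 3, ‖u (y + unitVec μ) - u y‖ ^ 2 ≤
          (∑ y ∈ box z ((ρ₁ : ℤ) - h - 1), ∑ μ : Fin 3, ‖v (y + unitVec μ) - v y‖ ^ 2) +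
          C * ((N : ℝ)⁻¹ * (∑ y ∈ box z ((a : ℤ) + N * (h + 1)), ∑ μ : Fin 3,
                  (‖u (y + unitVec μ) - u y‖ ^ 2 + ‖v (y + unitVec μ) - v y‖ ^ 2)) +
               ((h : ℝ)⁻¹) ^ 2 * (3 * ∑ y ∈ box z ((a : ℤ) + N * (h + 1)) \ box z (a : ℤ), ‖u y - v y‖ ^ 2)) +
          δ * ρ₁ := by
  classical
  obtain ⟨C, hC0, hC⟩ := exists_glued_le
  refine ⟨C, hC0, ?_⟩
  intro u v Z z R δ hu hv hδ hmin a h N h1 hN hsub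
  -- the good layer
  set W : Zd 3 → ℝ := fun y => ∑ μ : Fin 3, (‖u (y + unitVec μ) - u y‖ ^ 2 + ‖v (y + unitVec μ) - v y‖ ^ 2) with hW
  have hW0 : ∀ y, 0 ≤ W y := fun y => Finset.sum_nonneg fun μ _ => by positivity
  obtain ⟨i, hi, hlay⟩ := exists_layer_le W hW0 z a h N hN
  -- the glued radius
  refine ⟨a + (i + 1) * (h + 1), by nlinarith, by nlinarith, ?_⟩
  have hcast1 : ((a + (i + 1) * (h + 1) : ℕ) : ℤ) = (a : ℤ) + (i + 1) * (h + 1) := by push_cast; ring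
  have hcast2 : (a : ℤ) + (i + 1) * (h + 1) - h - 1 = (a : ℤ) + i * (h + 1) := by ring
  obtain ⟨w, hw1, hwu, hwE⟩ := hC u v z (a + (i + 1) * (h + 1)) h hu hv h1 (by nlinarith)
  rw [hcast1] at hwE hwu ⊢
  rw [hcast2] at hwE ⊢
  -- almost-minimality of `u` on `Q_{ρ₁}(z)` tested with `w` (`ρ = ρ₁ − 1`)
  have hρ0 : (0 : ℤ) ≤ (a : ℤ) + (i + 1) * (h + 1) - 1 := by
    have : (1 : ℤ) ≤ (i + 1) * (h + 1) := by nlinarith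
    linarith
  have hboxsub : box z ((a : ℤ) + (i + 1) * (h + 1) - 1 + 1) ⊆ box Z R := by
    rw [sub_add_cancel]
    refine (box_mono z ?_).trans hsub
    have hi' : (i : ℤ) + 1 ≤ N := by exact_mod_cast hi
    nlinarith
  have hminw := hmin z ((a : ℤ) + (i + 1) * (h + 1) - 1) hρ0 hboxsub w hwu (fun y _ => hw1 y)
  rw [sub_add_cancel] at hminw
  -- the layer terms are `≤ N⁻¹ ·` the shell terms; the mismatch sum over the layer is `≤` the one over the whole shell
  have hN0 : (0 : ℝ) < N := by exact_mod_cast hN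
  have hlay' : ∑ y ∈ box z ((a : ℤ) + (i + 1) * (h + 1)) \ box z ((a : ℤ) + i * (h + 1)), W y
      ≤ (N : ℝ)⁻¹ * ∑ y ∈ box z ((a : ℤ) + N * (h + 1)), W y := by
    rw [le_inv_mul_iff₀ hN0]; exact hlay
  have hmis : ∑ y ∈ box z ((a : ℤ) + (i + 1) * (h + 1)) \ box z ((a : ℤ) + i * (h + 1)), ‖u y - v y‖ ^ 2
      ≤ ∑ y ∈ box z ((a : ℤ) + N * (h + 1)) \ box z (a : ℤ), ‖u y - v y‖ ^ 2 := by
    refine Finset.sum_le_sum_of_subset_of_nonneg ?_ fun y _ _ => by positivity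
    refine Finset.sdiff_subset_sdiff (box_mono z ?_) (box_mono z ?_)
    · have hi' : (i : ℤ) + 1 ≤ N := by exact_mod_cast hi
      nlinarith
    · nlinarith
  have hh : (0 : ℝ) ≤ ((h : ℝ)⁻¹) ^ 2 := by positivity
  have hδρ : δ * (((a : ℤ) + (i + 1) * (h + 1) - 1 : ℤ) + 1 : ℝ) = δ * ((a + (i + 1) * (h + 1) : ℕ) : ℝ) := by
    push_cast; ring
  rw [hδρ] at hminw
  have key := mul_le_mul_of_nonneg_left (add_le_add hlay' (mul_le_mul_of_nonneg_left (mul_le_mul_of_nonneg_left hmis (by norm_num : (0:ℝ) ≤ 3)) hh)) hC0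
  linarith [hwE, hminw, key]

end Summit.QuantumFields.YangMills.Theorems.PoincareLipschitzLatticeToContinuumLatticeLetters

end
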